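import Summits.FinalStateConjecture.FinalStateConjecture.Theorems.EIHFluxBalanceModulatedKerrHandoffBentLabDeviationAux1

/-!
# Route EIHFluxBalance — `ModulatedKerrHandoff`, line `swallow-transfer`: decay of the derivatives of the radial height (part 2)

Helper file for the crux `stmt-FinalStateConjecture-10167`
(`Summit.FinalStateConjecture.FinalStateConjecture.Theses.EIHFluxBalance.ModulatedKerrHandoff`), stub
`stub_bentLabDeviation` of the line `swallow-transfer`.

For the radial height `x ↦ T(|x̲|)`, `T = bentHeight M a` (which is the Boyer–Lindquist height
`F(r) − F(4M)`, `F(r) = (M/σ)(r₊ log(r − r₊) − r₋ log(r − r₋))`, beyond `8M`), all derivatives of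
orders `1 ≤ j ≤ 4` decay like `B/|x̲|` (`bentLabDeviation_radialHeight_decay`, the registered sub-goal of this file). Proof by SCALING
and COMPACTNESS (the pattern of `Literature.Geometry.Lorentzian.Kerr.norm_iteratedFDeriv_ksPert_le`):
with `λ = |x̲|` and `u = 1/λ`, `T(|λ z̲|) = G(u, z) + κ(λ)` near the unit shell, where
`G(u, z) = (M/σ)(r₊ log(|z̲| − r₊ u) − r₋ log(|z̲| − r₋ u))` is jointly smooth on a neighbourhood
of the compact set `[0, u₀/2] × {0 ≤ z⁰ ≤ 1, |z̲| = 1}`; so `‖Dʲ(T ∘ |·̲|)(x)‖ ≤ λ^{-j} ‖Dʲ G(u, z)‖ ≤ B/λ`.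
[folklore]
-/

-- `Summit.FinalStateConjecture.FinalStateConjecture.…` is the summit's mandated namespace (summit = problem name)
set_option linter.dupNamespace false

noncomputable section

open Set Filter Topology Function
open scoped ContDiff Topology
open Literature.Geometry.Lorentzian
open Summit.FinalStateConjecture.FinalStateConjecture.Theorems.KerrShieldedDataExist.Negative
  (bentHeight blHeight bentHeight_eq_zero_of_le bentHeight_eq_of_ge mass_pos sq_sub_sq_pos
    rMinus_nonneg rMinus_lt_rPlus contDiff_bentHeight)
open Summit.FinalStateConjecture.FinalStateConjecture.Theorems.SwallowTheDatum.UniversalWitnessFamily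
  (contDiffAt_spatialNorm contDiff_apply_zero)

namespace Summit.FinalStateConjecture.FinalStateConjecture.Theorems.BentLabDeviation

variable {M a : ℝ}

/-- **Joint smoothness of the rescaled Boyer–Lindquist height**
`G(u, z) = (M/σ)(r₊ log(|z̲| − r₊ u) − r₋ log(|z̲| − r₋ u))` on the open set
`{|u| < 1/(4(r₊ + 1)), |z̲| > 1/2}` (both logarithms have positive arguments there). [folklore] -/
theorem contDiffOn_rescaledHeight (h : |a| < M) :
    ContDiffOn ℝ ∞ (fun q : ℝ × E4 ↦ M / Real.sqrt (M ^ 2 - a ^ 2) *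
        (Kerr.rPlus M a * Real.log (E4.spatialNorm q.2 - Kerr.rPlus M a * q.1) -
          Kerr.rMinus M a * Real.log (E4.spatialNorm q.2 - Kerr.rMinus M a * q.1)))
      {q : ℝ × E4 | |q.1| < 1 / (4 * (Kerr.rPlus M a + 1)) ∧ 1 / 2 < E4.spatialNorm q.2} := by
  intro q hq
  obtain ⟨hu, hρ⟩ := hq
  have hrp : 0 < Kerr.rPlus M a := by
    have hM' := mass_pos h
    unfold Kerr.rPlus
    positivity
  have hrm0 := rMinus_nonneg h
  have hrm := rMinus_lt_rPlus h
  have hu4 : Kerr.rPlus M a * |q.1| < 1 / 4 := by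
    have h1 : Kerr.rPlus M a * |q.1| < Kerr.rPlus M a * (1 / (4 * (Kerr.rPlus M a + 1))) :=
      mul_lt_mul_of_pos_left hu hrp
    refine h1.trans_le ?_
    rw [mul_one_div, div_le_div_iff₀ (by positivity) (by norm_num)]
    linarith
  have hq1 : Kerr.rPlus M a * q.1 < 1 / 4 :=
    (mul_le_mul_of_nonneg_left (le_abs_self _) hrp.le).trans_lt hu4
  have hq2 : Kerr.rMinus M a * q.1 < 1 / 4 := by
    have : Kerr.rMinus M a * q.1 ≤ Kerr.rMinus M a * |q.1| :=
      mul_le_mul_of_nonneg_left (le_abs_self _) hrm0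
    nlinarith [abs_nonneg q.1]
  have hpos1 : E4.spatialNorm q.2 - Kerr.rPlus M a * q.1 ≠ 0 := by linarith
  have hpos2 : E4.spatialNorm q.2 - Kerr.rMinus M a * q.1 ≠ 0 := by linarith
  have hρ0 : E4.spatialNorm q.2 ≠ 0 := by linarith
  have hsn : ContDiffAt ℝ ∞ (fun q : ℝ × E4 ↦ E4.spatialNorm q.2) q :=
    (contDiffAt_spatialNorm hρ0).comp q contDiffAt_snd
  have hfst : ContDiffAt ℝ ∞ (fun q : ℝ × E4 ↦ q.1) q := contDiffAt_fst
  apply ContDiffAt.contDiffWithinAt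
  apply ContDiffAt.mul contDiffAt_const
  apply ContDiffAt.sub
  · exact contDiffAt_const.mul ((hsn.sub (contDiffAt_const.mul hfst)).log hpos1)
  · exact contDiffAt_const.mul ((hsn.sub (contDiffAt_const.mul hfst)).log hpos2)

/-- **The scaling identity.** For `λ ≥ max (16M) (8(r₊ + 1))` and `|z̲| > 1/2`:
`T(|λ z̲|) = G(λ⁻¹, z) + κ(λ)` with the constant
`κ(λ) = T(λ) + (M/σ)(r₊ (log λ − log(λ − r₊)) − r₋ (log λ − log(λ − r₋)))`
(both `λ|z̲|` and `λ` lie beyond `8M`, where `T = F − F(4M)`, and `log(λ|z̲| − c) = log λ + log(|z̲| − c/λ)`).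
[folklore] -/
theorem radialHeight_smul_eq (h : |a| < M) {lam : ℝ}
    (hlam : max (16 * M) (8 * (Kerr.rPlus M a + 1)) ≤ lam) {z : E4} (hz : 1 / 2 < E4.spatialNorm z) :
    bentHeight M a (E4.spatialNorm (lam • z)) =
      M / Real.sqrt (M ^ 2 - a ^ 2) *
        (Kerr.rPlus M a * Real.log (E4.spatialNorm z - Kerr.rPlus M a * lam⁻¹) -
          Kerr.rMinus M a * Real.log (E4.spatialNorm z - Kerr.rMinus M a * lam⁻¹)) +
      (bentHeight M a lam + M / Real.sqrt (M ^ 2 - a ^ 2) *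
        (Kerr.rPlus M a * (Real.log lam - Real.log (lam - Kerr.rPlus M a)) -
          Kerr.rMinus M a * (Real.log lam - Real.log (lam - Kerr.rMinus M a)))) := by
  have hM := mass_pos h
  have hrp : 0 < Kerr.rPlus M a := by
    have hM' := mass_pos h
    unfold Kerr.rPlus
    positivity
  have hrm0 := rMinus_nonneg h
  have hrm := rMinus_lt_rPlus h
  have h16 : 16 * M ≤ lam := (le_max_left _ _).trans hlam
  have h8 : 8 * (Kerr.rPlus M a + 1) ≤ lam := (le_max_right _ _).trans hlam
  have hlam0 : 0 < lam := by linarith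
  set ρ := E4.spatialNorm z with hρ
  have hR : E4.spatialNorm (lam • z) = lam * ρ := by
    rw [Kerr.spatialNorm_smul, abs_of_pos hlam0]
  have hR8 : 8 * M ≤ lam * ρ := by nlinarith
  rw [hR, bentHeight_eq_of_ge hM hR8, bentHeight_eq_of_ge hM (by linarith)]
  -- the two logarithm identities
  have hlog : ∀ c : ℝ, 0 ≤ c → c ≤ Kerr.rPlus M a →
      Real.log (lam * ρ - c) = Real.log lam + Real.log (ρ - c * lam⁻¹) := by
    intro c hc0 hc1
    have hpos : 0 < ρ - c * lam⁻¹ := by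
      rw [sub_pos, ← div_eq_mul_inv, div_lt_iff₀ hlam0]
      nlinarith
    have e : lam * ρ - c = lam * (ρ - c * lam⁻¹) := by
      field_simp
    rw [e, Real.log_mul hlam0.ne' hpos.ne']
  have h1 := hlog (Kerr.rPlus M a) hrp.le le_rfl
  have h2 := hlog (Kerr.rMinus M a) hrm0 hrm.le
  unfold blHeight
  rw [h1, h2]
  ring

/-- **Uniform bound near the unit shell.** For every order `j` there is `B` with
`‖Dʲ G(u, z)‖ ≤ B` for `u ∈ [0, 1/(8(r₊+1))]`, `0 ≤ z⁰ ≤ 1`, `|z̲| = 1` (continuity of `Dʲ G` on the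
open set of `contDiffOn_rescaledHeight`, compactness). [folklore] -/
theorem exists_bound_iteratedFDeriv_rescaledHeight (h : |a| < M) (j : ℕ) :
    ∃ B : ℝ, ∀ (u : ℝ) (z : E4), 0 ≤ u → u ≤ 1 / (8 * (Kerr.rPlus M a + 1)) → 0 ≤ z 0 → z 0 ≤ 1 →
      E4.spatialNorm z = 1 →
      ‖iteratedFDeriv ℝ j (fun q : ℝ × E4 ↦ M / Real.sqrt (M ^ 2 - a ^ 2) *
        (Kerr.rPlus M a * Real.log (E4.spatialNorm q.2 - Kerr.rPlus M a * q.1) -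
          Kerr.rMinus M a * Real.log (E4.spatialNorm q.2 - Kerr.rMinus M a * q.1))) (u, z)‖ ≤ B := by
  have hrp : 0 < Kerr.rPlus M a := by
    have hM' := mass_pos h
    unfold Kerr.rPlus
    positivity
  set G : ℝ × E4 → ℝ := fun q ↦ M / Real.sqrt (M ^ 2 - a ^ 2) *
    (Kerr.rPlus M a * Real.log (E4.spatialNorm q.2 - Kerr.rPlus M a * q.1) -
      Kerr.rMinus M a * Real.log (E4.spatialNorm q.2 - Kerr.rMinus M a * q.1)) with hG
  set O : Set (ℝ × E4) :=
    {q | |q.1| < 1 / (4 * (Kerr.rPlus M a + 1)) ∧ 1 / 2 < E4.spatialNorm q.2} with hO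
  have hOo : IsOpen O :=
    (isOpen_lt (continuous_abs.comp continuous_fst) continuous_const).inter
      (isOpen_lt continuous_const (continuous_spatialNorm.comp continuous_snd))
  have hcd : ContDiffOn ℝ ∞ G O := contDiffOn_rescaledHeight h
  have hcont : ContinuousOn (iteratedFDeriv ℝ j G) O := by
    have h1 := hcd.continuousOn_iteratedFDerivWithin (m := j) (by exact_mod_cast le_top)
      hOo.uniqueDiffOn
    exact h1.congr fun p hp ↦ (iteratedFDerivWithin_of_isOpen j hOo hp).symm
  set K : Set (ℝ × E4) := Icc 0 (1 / (8 * (Kerr.rPlus M a + 1))) ×ˢ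
    {z : E4 | z 0 ∈ Icc (0 : ℝ) 1 ∧ E4.spatialNorm z = 1} with hK
  have hKc : IsCompact K := by
    refine isCompact_Icc.prod ?_
    have hclosed : IsClosed {z : E4 | z 0 ∈ Icc (0 : ℝ) 1 ∧ E4.spatialNorm z = 1} :=
      (isClosed_Icc.preimage continuous_apply_zero).inter
        (isClosed_eq continuous_spatialNorm continuous_const)
    refine Metric.isCompact_of_isClosed_isBounded hclosed ?_
    refine (Metric.isBounded_closedBall (x := (0 : E4)) (r := 2)).subset ?_
    intro z hz
    rw [Metric.mem_closedBall, dist_zero_right]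
    have hsq : ‖z‖ ^ 2 ≤ 2 := by
      rw [norm_sq_eq_sq_add_spatialNorm_sq, hz.2]
      nlinarith [hz.1.1, hz.1.2]
    nlinarith [norm_nonneg z]
  have hKO : K ⊆ O := by
    rintro ⟨u, z⟩ ⟨hu, hz⟩
    refine ⟨?_, ?_⟩
    · show |u| < 1 / (4 * (Kerr.rPlus M a + 1))
      rw [abs_of_nonneg hu.1]
      refine hu.2.trans_lt ?_
      exact one_div_lt_one_div_of_lt (by positivity) (by linarith)
    · show 1 / 2 < E4.spatialNorm z
      rw [hz.2]
      norm_num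
  obtain ⟨B, hB⟩ := hKc.exists_bound_of_continuousOn (hcont.mono hKO)
  exact ⟨B, fun u z hu0 hu1 hz0 hz1 hz ↦ hB (u, z) ⟨⟨hu0, hu1⟩, ⟨hz0, hz1⟩, hz⟩⟩

/-- **Decay of the derivatives of the radial height** (registered sub-goal of this file): there are
`B ≥ 0` and `R₁ > 0` with
`‖Dʲ (T ∘ |·̲|)(x)‖ ≤ B / |x̲|` for `1 ≤ j ≤ 4` whenever `|x̲| ≥ R₁` and `0 ≤ x⁰ ≤ |x̲|` (scaling
by `λ = |x̲|`, the identity `radialHeight_smul_eq`, the slice estimate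
`Kerr.norm_iteratedFDeriv_slice_le` and the compactness bound). [folklore] -/
theorem bentLabDeviation_radialHeight_decay : open Literature.Geometry.Lorentzian in ∀ {M a : ℝ}, |a| < M → ∃ B R₁ : ℝ, 0 ≤ B ∧ 0 < R₁ ∧ ∀ j : ℕ, 1 ≤ j → j ≤ 4 → ∀ y : E4, R₁ ≤ E4.spatialNorm y → 0 ≤ y 0 → y 0 ≤ E4.spatialNorm y → ‖iteratedFDeriv ℝ j (fun z : E4 ↦ Summit.FinalStateConjecture.FinalStateConjecture.Theorems.KerrShieldedDataExist.Negative.bentHeight M a (E4.spatialNorm z)) y‖ ≤ B / E4.spatialNorm y := by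
  intro M a h
  have hM := mass_pos h
  have hrp : 0 < Kerr.rPlus M a := by
    have hM' := mass_pos h
    unfold Kerr.rPlus
    positivity
  choose Bj hBj using exists_bound_iteratedFDeriv_rescaledHeight h
  set B : ℝ := max 0 (∑ j ∈ Finset.range 5, |Bj j|) with hB
  set Λ₀ : ℝ := max (16 * M) (8 * (Kerr.rPlus M a + 1)) with hΛ₀
  refine ⟨B, max Λ₀ 1, le_max_left _ _, lt_max_of_lt_right one_pos, fun j hj1 hj4 y hy hy0 hy1 ↦ ?_⟩
  set G : ℝ × E4 → ℝ := fun q ↦ M / Real.sqrt (M ^ 2 - a ^ 2) *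
    (Kerr.rPlus M a * Real.log (E4.spatialNorm q.2 - Kerr.rPlus M a * q.1) -
      Kerr.rMinus M a * Real.log (E4.spatialNorm q.2 - Kerr.rMinus M a * q.1)) with hG
  set O : Set (ℝ × E4) :=
    {q | |q.1| < 1 / (4 * (Kerr.rPlus M a + 1)) ∧ 1 / 2 < E4.spatialNorm q.2} with hO
  have hOo : IsOpen O :=
    (isOpen_lt (continuous_abs.comp continuous_fst) continuous_const).inter
      (isOpen_lt continuous_const (continuous_spatialNorm.comp continuous_snd))
  have hcd : ContDiffOn ℝ ∞ G O := contDiffOn_rescaledHeight h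
  set Tρ : E4 → ℝ := fun z ↦ bentHeight M a (E4.spatialNorm z) with hTρ
  -- the scale and the rescaled point
  set lam : ℝ := E4.spatialNorm y with hlam
  have hΛ : Λ₀ ≤ lam := (le_max_left _ _).trans hy
  have hlam1 : 1 ≤ lam := (le_max_right _ _).trans hy
  have hlam0 : 0 < lam := one_pos.trans_le hlam1
  have h8 : 8 * (Kerr.rPlus M a + 1) ≤ lam := (le_max_right _ _).trans hΛ
  set u : ℝ := lam⁻¹ with hu
  have hu0 : 0 < u := inv_pos.mpr hlam0
  have hu1 : u ≤ 1 / (8 * (Kerr.rPlus M a + 1)) := by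
    rw [hu, one_div]
    exact inv_anti₀ (by positivity) h8
  set z : E4 := u • y with hz
  have hzρ : E4.spatialNorm z = 1 := by
    rw [hz, Kerr.spatialNorm_smul, abs_of_pos hu0, ← hlam, hu, inv_mul_cancel₀ hlam0.ne']
  have hz0 : z 0 = u * y 0 := smul_apply_zero u y
  have hz00 : 0 ≤ z 0 := by rw [hz0]; positivity
  have hz01 : z 0 ≤ 1 := by
    rw [hz0, hu, inv_mul_le_iff₀ hlam0, mul_one]
    exact hy1
  -- scaling of the iterated derivative
  set F : E4 → ℝ := fun w ↦ Tρ (lam • w) with hF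
  have hFcd : ContDiff ℝ ∞ F := (contDiff_radialHeight h).comp (contDiff_const_smul lam)
  have hfun : Tρ = fun w ↦ (1 : ℝ) • F (u • w) := by
    funext w
    rw [one_smul, hF]
    simp only [hu, smul_smul, mul_inv_cancel₀ hlam0.ne', one_smul]
  have hkey := norm_iteratedFDeriv_const_smul_comp_smul_le F 1 hu0.ne' y (m := j)
    (hFcd.of_le (by exact_mod_cast le_top)).contDiffAt
  -- near `z`, `F` is the slice of `G` at `u` plus a constant
  set κ : ℝ := bentHeight M a lam + M / Real.sqrt (M ^ 2 - a ^ 2) *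
    (Kerr.rPlus M a * (Real.log lam - Real.log (lam - Kerr.rPlus M a)) -
      Kerr.rMinus M a * (Real.log lam - Real.log (lam - Kerr.rMinus M a))) with hκ
  have hev : F =ᶠ[𝓝 z] fun w ↦ G (u, w) + κ := by
    have hopen : IsOpen {w : E4 | 1 / 2 < E4.spatialNorm w} :=
      isOpen_lt continuous_const continuous_spatialNorm
    have hmem : z ∈ {w : E4 | 1 / 2 < E4.spatialNorm w} := by
      show 1 / 2 < E4.spatialNorm z
      rw [hzρ]; norm_num
    filter_upwards [hopen.mem_nhds hmem] with w hw
    rw [hF, hTρ, hG, hκ]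
    exact radialHeight_smul_eq h hΛ hw
  have hmemO : (u, z) ∈ O := by
    refine ⟨?_, ?_⟩
    · show |u| < 1 / (4 * (Kerr.rPlus M a + 1))
      rw [abs_of_pos hu0]
      exact hu1.trans_lt (one_div_lt_one_div_of_lt (by positivity) (by linarith))
    · show 1 / 2 < E4.spatialNorm z
      rw [hzρ]; norm_num
  have hGat : ContDiffAt ℝ ∞ G (u, z) := (hcd (u, z) hmemO).contDiffAt (hOo.mem_nhds hmemO)
  have hslice_cd : ContDiffAt ℝ j (fun w : E4 ↦ G (u, w)) z :=
    (hGat.comp z (contDiffAt_const.prodMk contDiffAt_id)).of_le (by exact_mod_cast le_top)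
  have hderiv : iteratedFDeriv ℝ j F z = iteratedFDeriv ℝ j (fun w : E4 ↦ G (u, w)) z := by
    rw [(hev.iteratedFDeriv ℝ j).eq_of_nhds]
    have hsum : (fun w ↦ G (u, w) + κ) = (fun w : E4 ↦ G (u, w)) + fun _ ↦ κ := rfl
    rw [hsum, iteratedFDeriv_add_apply hslice_cd contDiffAt_const,
      iteratedFDeriv_const_of_ne (by omega)]
    simp
  have hslice := Kerr.norm_iteratedFDeriv_slice_le hOo hcd hmemO (i := j) (by exact_mod_cast le_top)
  have hBj_le : Bj j ≤ B :=
    ((le_abs_self _).trans (Finset.single_le_sum (f := fun i ↦ |Bj i|)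
      (fun i _ ↦ abs_nonneg (Bj i)) (Finset.mem_range.mpr (by omega)))).trans (le_max_right _ _)
  have hB0 : 0 ≤ B := le_max_left _ _
  have hbound : ‖iteratedFDeriv ℝ j F z‖ ≤ B := by
    rw [hderiv]
    exact hslice.trans ((hBj j u z hu0.le hu1 hz00 hz01 hzρ).trans hBj_le)
  have huj : u ^ j ≤ u := by
    have hu1' : u ≤ 1 := by rw [hu]; exact inv_le_one_of_one_le₀ hlam1
    calc u ^ j ≤ u ^ 1 := pow_le_pow_of_le_one hu0.le hu1' hj1
      _ = u := pow_one u
  calc ‖iteratedFDeriv ℝ j Tρ y‖ = ‖iteratedFDeriv ℝ j (fun w ↦ (1 : ℝ) • F (u • w)) y‖ := by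
        rw [← hfun]
    _ ≤ |(1 : ℝ)| * |u| ^ j * ‖iteratedFDeriv ℝ j F (u • y)‖ := hkey
    _ ≤ 1 * u * B := by
        rw [abs_one, abs_of_pos hu0]
        exact mul_le_mul (mul_le_mul_of_nonneg_left huj zero_le_one) hbound (norm_nonneg _)
          (by positivity)
    _ = B / E4.spatialNorm y := by
        rw [one_mul, hu, hlam, div_eq_inv_mul]

end Summit.FinalStateConjecture.FinalStateConjecture.Theorems.BentLabDeviation

end
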